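/-
COR-CM (cell pub-hodgecm2, stage 2 of the Hodge ladder) — count-neutral KERNEL COMBINATORICS «order 16: the quaternion doublings», part XI: the DIHEDRAL-EQUIVALENCE
BRICK for the order-16 assembly — `DihedralGroup n ≃* G` from a dihedral presentation, and seat b09 gen 46ʼs dihedral kernel-two law on ABSTRACT quotient data
(seat prover-pub-hodgecm2-b23-g54-0, binder prover b23, gen 54; claim HOME/INBOX.md l.25095).  Bookkeeping definitions with bodies (`dihedralMap`, `dihedralHom`,
`dihedralEquiv`) + theorems, mirroring seat b23 gen 50ʼs `Census/IndexTwoCyclicQuaternion.lean` (`quaternionEquiv`); b09ʼs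
`CentralSquares.isLeast_card_gfaces_generate_of_dihedral_kernel_two` BY NAME; no `decide`, no certificate, no named fact, no `sorry`.  `Interfaces.lean` (C1),
every E term, B01, `Transposition/*`, `PortJoin/*`, `D2Bridge/*` untouched.
HONEST FRAMING: `HC_CM` is NOT proved, here or anywhere in the tree; nothing here is a period, a count of record or a headline.
T5: n/a-class (hypothesis binders: a dihedral presentation `ord u = n`, `[K : ⟨u⟩] = 2`, `w ∉ ⟨u⟩`, `w² = 1`, `w u w⁻¹ = u⁻¹` — inhabited by `DihedralGroup n`
itself (`dihedralGroup_presentation`); resp. such a presentation of `G ⧸ N`, `|N| = 2` — inhabited by `D₄ × ℤ/2`, `ℤ/4 ⋊ ℤ/4`, `G(16,3)`); checker: self.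
-/
import Summits.HodgeConjecture.CorCM.Census.CentralSquaresDihedralKernelTwo
import Summits.HodgeConjecture.CorCM.Census.QuaternionDoublingDatum

/-!
# The quaternion doublings, XI: the dihedral-equivalence brick

* §1 `ℤ/n`-indexed powers of an element of order `n`.
* §2 **`dihedralEquiv : DihedralGroup n ≃* K`** for an abstract dihedral presentation: `u` of order `n` with `[K : ⟨u⟩] = 2`, `w ∉ ⟨u⟩`, `w² = 1`,
  `w u w⁻¹ = u⁻¹` (`r i ↦ uⁱ`, `sr i ↦ w uⁱ`); the model carries the presentation (`dihedralGroup_presentation`).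
* §3 **b09ʼs dihedral kernel-two law on abstract quotient data** (`isLeast_card_gfaces_generate_fibreTwo_of_dihedral_quotient_data`): `c` a central involution,
  `N ⊴ G` with `|N| = 2`, and a dihedral presentation of order `8` of `G ⧸ N` (`ū` of order `4`, `[G⧸N : ⟨ub⟩] = 2`, an involution `w̄ ∉ ⟨ub⟩` inverting `ū`) with
  `c̄ = ub²` ⟹ `μ(G, c) = φ₂(G, c)` — the surjection `G ↠ G⧸N ≅ D₄` has kernel `N` of order `2` and sends `c` to `r 2`.  This is the brick the classification-free
  ORDER-16 ASSEMBLY needs for the rows `D₄ × ℤ/2`, `ℤ/4 ⋊ ℤ/4`, `G(16,3)` (design note `QUATERNION-DOUBLING.md` §5).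
All [folklore].

## References
* [Pohlmann1968] H. Pohlmann, Algebraic cycles on abelian varieties of complex multiplication type, Ann. of Math. 88 (1968), Thm 1.
-/

namespace Summit.HodgeConjecture.CorCM.Census.QuaternionDoubling

open DihedralGroup
open Summit.HodgeConjecture.CorCM.Prior.AllgGroup.RfwfAllgGroup
open Summit.HodgeConjecture.CorCM.Census.BlockParity
open Summit.HodgeConjecture.CorCM.Census.Coinvariant

noncomputable section

variable {K : Type*} [Group K] {n : ℕ}

/-! ## §1 Powers indexed by `ℤ/n` -/

/-- `ℤ/n`-indexed powers of an element of order `n`. [folklore] -/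
theorem dpow_val_add [NeZero n] {u : K} (hord : orderOf u = n) (i j : ZMod n) : u ^ (i + j).val = u ^ i.val * u ^ j.val := by
  have h := pow_mod_orderOf u (i.val + j.val)
  rw [hord] at h
  rw [ZMod.val_add, h, pow_add]

/-- `u^{(−i)} = (u^{i})⁻¹`. [folklore] -/
theorem dpow_val_neg [NeZero n] {u : K} (hord : orderOf u = n) (i : ZMod n) : u ^ (-i).val = (u ^ i.val)⁻¹ := by
  apply eq_inv_of_mul_eq_one_left
  rw [← dpow_val_add hord, neg_add_cancel, ZMod.val_zero, pow_zero]

/-- `u^{(k : ℤ/n)} = uᵏ`. [folklore] -/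
theorem dpow_val_natCast {u : K} (hord : orderOf u = n) (k : ℕ) : u ^ ((k : ZMod n)).val = u ^ k := by
  rw [ZMod.val_natCast, ← hord, pow_mod_orderOf]

/-- Under `w u w⁻¹ = u⁻¹`: `u^{i} · w = w · u^{(−i)}`. [folklore] -/
theorem dpow_val_mul_w [NeZero n] {u w : K} (hord : orderOf u = n) (hwu : w * u * w⁻¹ = u⁻¹) (i : ZMod n) :
    u ^ i.val * w = w * u ^ (-i).val := by
  have h : w * u ^ (-i).val * w⁻¹ = (u ^ (-i).val)⁻¹ := by
    rw [← MulAut.conj_apply, map_pow, MulAut.conj_apply, hwu, inv_pow]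
  rw [dpow_val_neg hord, inv_inv] at h
  calc u ^ i.val * w = (w * (u ^ i.val)⁻¹ * w⁻¹) * w := by rw [h]
    _ = w * (u ^ i.val)⁻¹ := by rw [inv_mul_cancel_right]
    _ = w * u ^ (-i).val := by rw [dpow_val_neg hord]

/-! ## §2 The isomorphism `DihedralGroup n ≃* K` of a dihedral presentation -/

/-- **The map of a dihedral presentation**: `rⁱ ↦ uⁱ`, `s rⁱ ↦ w uⁱ`. [folklore] -/
def dihedralMap (u w : K) : DihedralGroup n → K
  | r i => u ^ i.val
  | sr i => w * u ^ i.val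

/-- The map of a dihedral presentation is multiplicative. [folklore] -/
theorem dihedralMap_mul [NeZero n] {u w : K} (hord : orderOf u = n) (hww : w * w = 1) (hwu : w * u * w⁻¹ = u⁻¹)
    (x y : DihedralGroup n) : dihedralMap u w (x * y) = dihedralMap u w x * dihedralMap u w y := by
  cases x with
  | r i =>
    cases y with
    | r j => simp only [r_mul_r, dihedralMap, dpow_val_add hord]
    | sr j =>
      simp only [r_mul_sr, dihedralMap]
      rw [← mul_assoc, dpow_val_mul_w hord hwu, mul_assoc, ← dpow_val_add hord, neg_add_eq_sub]
  | sr i =>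
    cases y with
    | r j => simp only [sr_mul_r, dihedralMap, dpow_val_add hord, mul_assoc]
    | sr j =>
      simp only [sr_mul_sr, dihedralMap]
      rw [mul_assoc, ← mul_assoc (u ^ i.val), dpow_val_mul_w hord hwu, mul_assoc, ← mul_assoc w w, hww, one_mul, ← dpow_val_add hord,
        neg_add_eq_sub]

/-- The map of a dihedral presentation as a group homomorphism. [folklore] -/
def dihedralHom [NeZero n] {u w : K} (hord : orderOf u = n) (hww : w * w = 1) (hwu : w * u * w⁻¹ = u⁻¹) : DihedralGroup n →* K :=
  MonoidHom.mk' (dihedralMap u w) (dihedralMap_mul hord hww hwu)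

/-- The map of a dihedral presentation is onto when `[K : ⟨u⟩] = 2` and `w ∉ ⟨u⟩`. [folklore] -/
theorem dihedralMap_surjective [Finite K] {u w : K} (hord : orderOf u = n) (hindex : (Subgroup.zpowers u).index = 2)
    (hw : w ∉ Subgroup.zpowers u) : Function.Surjective (dihedralMap (n := n) u w) := by
  have hpow : ∀ z : K, z ∈ Subgroup.zpowers u → ∃ i : ZMod n, u ^ i.val = z := by
    intro z hz
    have hz' : z ∈ Submonoid.powers u := ((isOfFinOrder_of_finite u).mem_powers_iff_mem_zpowers).mpr hz
    obtain ⟨k, rfl⟩ := (Submonoid.mem_powers_iff _ _).mp hz'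
    exact ⟨k, dpow_val_natCast hord k⟩
  intro x
  by_cases hx : x ∈ Subgroup.zpowers u
  · obtain ⟨i, hi⟩ := hpow x hx
    exact ⟨r i, hi⟩
  · have hwx : w⁻¹ * x ∈ Subgroup.zpowers u := by
      rw [Subgroup.mul_mem_iff_of_index_two hindex, Subgroup.inv_mem_iff]
      exact ⟨fun h => absurd h hw, fun h => absurd h hx⟩
    obtain ⟨i, hi⟩ := hpow _ hwx
    exact ⟨sr i, by change w * u ^ i.val = x; rw [hi, mul_inv_cancel_left]⟩

/-- `|K| = 2n` when `ord u = n` and `[K : ⟨u⟩] = 2`. [folklore] -/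
theorem card_eq_two_mul [Fintype K] {u : K} (hord : orderOf u = n) (hindex : (Subgroup.zpowers u).index = 2) : Fintype.card K = 2 * n := by
  have h := (Subgroup.zpowers u).card_mul_index
  rw [hindex, Nat.card_zpowers, hord, Nat.card_eq_fintype_card] at h
  omega

/-- **THE ISOMORPHISM OF A DIHEDRAL PRESENTATION** `DihedralGroup n ≃* K`: `ord u = n`, `[K : ⟨u⟩] = 2`, `w ∉ ⟨u⟩`, `w² = 1`, `w u w⁻¹ = u⁻¹`. [folklore] -/
def dihedralEquiv [Fintype K] [NeZero n] {u w : K} (hord : orderOf u = n) (hindex : (Subgroup.zpowers u).index = 2) (hw : w ∉ Subgroup.zpowers u)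
    (hww : w * w = 1) (hwu : w * u * w⁻¹ = u⁻¹) : DihedralGroup n ≃* K :=
  MulEquiv.ofBijective (dihedralHom hord hww hwu)
    ((Fintype.bijective_iff_surjective_and_card _).mpr
      ⟨dihedralMap_surjective hord hindex hw, by rw [DihedralGroup.card, card_eq_two_mul hord hindex]⟩)

/-- The isomorphism on rotations: `r i ↦ u^{i}`. [folklore] -/
theorem dihedralEquiv_r [Fintype K] [NeZero n] {u w : K} (hord : orderOf u = n) (hindex : (Subgroup.zpowers u).index = 2)
    (hw : w ∉ Subgroup.zpowers u) (hww : w * w = 1) (hwu : w * u * w⁻¹ = u⁻¹) (i : ZMod n) :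
    dihedralEquiv hord hindex hw hww hwu (r i) = u ^ i.val := rfl

/-- The isomorphism on reflections: `s rⁱ ↦ w u^{i}`. [folklore] -/
theorem dihedralEquiv_sr [Fintype K] [NeZero n] {u w : K} (hord : orderOf u = n) (hindex : (Subgroup.zpowers u).index = 2)
    (hw : w ∉ Subgroup.zpowers u) (hww : w * w = 1) (hwu : w * u * w⁻¹ = u⁻¹) (i : ZMod n) :
    dihedralEquiv hord hindex hw hww hwu (sr i) = w * u ^ i.val := rfl

/-- The model itself carries the presentation: `u = r 1`, `w = sr 0` in `DihedralGroup n`. [folklore] -/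
theorem dihedralGroup_presentation [NeZero n] :
    orderOf (r 1 : DihedralGroup n) = n ∧ (sr (0 : ZMod n)) * sr 0 = 1 ∧ sr (0 : ZMod n) * r 1 * (sr 0)⁻¹ = (r 1)⁻¹ := by
  refine ⟨orderOf_r_one, ?_, ?_⟩
  · rw [sr_mul_sr, sub_self]; rfl
  · have hinv : (r 1 : DihedralGroup n)⁻¹ = r (-1) := inv_eq_of_mul_eq_one_right (by rw [r_mul_r, add_neg_cancel]; rfl)
    rw [mul_inv_eq_iff_eq_mul, hinv, sr_mul_r, r_mul_sr, zero_add, zero_sub, neg_neg]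

/-! ## §3 Seat b09ʼs dihedral kernel-two law on abstract quotient data -/

variable {G : Type*} [Group G] [Fintype G] [DecidableEq G]

/-- **THE DIHEDRAL KERNEL-TWO LAW ON ABSTRACT QUOTIENT DATA.**  `c` a central involution of the finite group `G`; `N ⊴ G` with `|N| = 2`; in `G ⧸ N` an
element `ū` of order `4` generating a subgroup of index two, an involution `w̄ ∉ ⟨ub⟩` inverting `ū`, and `c̄ = ub²`.  Then **`μ(G, c) = φ₂(G, c)`** — seat b09
gen 46ʼs `CentralSquares.isLeast_card_gfaces_generate_of_dihedral_kernel_two` along `G ↠ G⧸N ≅ D₄`. [folklore] -/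
theorem isLeast_card_gfaces_generate_fibreTwo_of_dihedral_quotient_data {c : G} (hc2 : c * c = 1) (hcen : ∀ x : G, x * c = c * x)
    (N : Subgroup G) [N.Normal] (hN : Nat.card N = 2) (ub wb : G ⧸ N) (hord : orderOf ub = 4) (hindex : (Subgroup.zpowers ub).index = 2)
    (hw : wb ∉ Subgroup.zpowers ub) (hww : wb * wb = 1) (hwu : wb * ub * wb⁻¹ = ub⁻¹) (hc : (QuotientGroup.mk c : G ⧸ N) = ub ^ 2) :
    IsLeast {m : ℕ | ∃ S : Finset (CMF G c →₀ ℤ), (↑S ⊆ gfaceSet G c hc2) ∧ S.card = m ∧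
      hodgeSpan c hc2 ≤ Submodule.span ℤ (pairSet c) ⊔ Submodule.span ℤ (translates c S)} (fibreTwo c hc2) := by
  classical
  haveI : Fintype (G ⧸ N) := Fintype.ofFinite _
  let e : DihedralGroup 4 ≃* G ⧸ N := dihedralEquiv hord hindex hw hww hwu
  let π : G →* DihedralGroup 4 := e.symm.toMonoidHom.comp (QuotientGroup.mk' N)
  have hπsurj : Function.Surjective π := e.symm.surjective.comp (QuotientGroup.mk'_surjective N)
  have hπc : π c = r 2 := by
    show e.symm (QuotientGroup.mk' N c) = r 2
    rw [MulEquiv.symm_apply_eq, QuotientGroup.mk'_apply, hc]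
    show ub ^ 2 = dihedralEquiv hord hindex hw hww hwu (r 2)
    rw [dihedralEquiv_r, show ((2 : ZMod 4)).val = 2 from rfl]
  have hker : π.ker = N := by
    ext g
    rw [MonoidHom.mem_ker]
    show e.symm (QuotientGroup.mk' N g) = 1 ↔ g ∈ N
    rw [MulEquiv.map_eq_one_iff, QuotientGroup.mk'_apply, QuotientGroup.eq_one_iff]
  have hkerN : Nat.card π.ker = 2 := by rw [hker, hN]
  exact CentralSquares.isLeast_card_gfaces_generate_of_dihedral_kernel_two hc2 hcen π hπsurj hπc hkerN

end

end Summit.HodgeConjecture.CorCM.Census.QuaternionDoubling
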